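import Literature.AnabelianGeometry.SemiGraphs.SectionFibreLocal
import Literature.AnabelianGeometry.SemiGraphs.HomRestrict
import Literature.AnabelianGeometry.Anabelioids.TerminalCoproductComponents
import HarnessLib

/-!
# Section fibres glue along the branches of a covering ([SemiAnbd] §2, proof of Cor. 2.7 (i) p. 30)

Mochizuki, *Semi-graphs of anabelioids*, Publ. RIMS **42** (2006), §2, proof of Corollary 2.7 (i),
author's manuscript p. 30 ("`ℋ′` injects into `𝒢′` as a subgraph": the restriction of the finite
étale covering `𝒢′ → 𝒢` attached to `A` to a component over `ℍ` is the covering of `𝒢_ℍ` attached to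
a component of `A|_ℍ`) [cite: MochizukiSemiAnbd2006, Cor. 2.7(i) p.30]; Remark 2.11.1 p. 32 (the
pull-back functor of a morphism; its gluing along a branch is the 2-isomorphism `φ_b` followed by
`φ_e^*` of the gluing of the base).

PROOF-ONLY tool-kit (abc-iut cell, layer L3, gap row G-L3-R1-E3 «(Surj) under branch alignment»,
abc-iut-L3-d3; part B of the sheet argument for SECTION FIBRES, after `SectionFibreLocal.lean`).
Setting: `φ : 𝒢′ → 𝒢`, `A ∈ B(𝒢)`, a section `s : T → φ^* A` from an object `T` with terminal
constituents, a sub-semi-graph `ℍ`, `Y ∈ B(𝒢_ℍ)` with `f : Y → A|_ℍ`.  At a vertex `ω ↦ u` and a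
sub-object `c ↪ Y_u` the *section fibre* is `Ψ_c := φ_ω^* c ×_{φ_ω^* A_u} T_ω`; at the edge `f′` of a
branch `β` abutting to `ω` (over `b` of `e`) and `d ↪ Y_e` it is `Ψ_d := φ_{f′}^* d ×_{φ_{f′}^* A_e} T_{f′}`
with the edge section TRANSPORTED from `s_ω` along `β` (`T.ψ_β⁻¹ ≫ β^* s_ω ≫ φ_β ≫ φ_{f′}^* ψ^A_b`; it
equals `s_{f′}` up to the re-indexing `edgeOf (φ β) = φ f′`, by `s ∈ Hom`).  This file proves:

* `subsingleton_fiber_of_isTerminal`, `nonempty_fiber_of_isTerminal`, `map_iso_injective` — fibre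
  bookkeeping;
* `Hom.pullbackFunctor_obj_ψ_hom` — the gluing of `φ^* X` along `β`, unfolded (definitional);
* `Hom.exists_point_pull_sectionFibre` — **section fibres glue along a branch**: if `d` lies under
  `c` along `b` (`k ≫ b^* ι_c ≫ ψ^Y_b = ι_d`), every point of the fibre-image of `Ψ_d → φ_{f′}^* Y_e`
  comes from a point of `β^* Ψ_c` through `β^*(Ψ_c → φ_ω^* Y_u)`, `φ_β` and `φ_{f′}^* ψ^Y_b` — i.e.
  along the gluing of `φ^* Y` at `β` (naturality of `φ_β`, compatibility of `f` with the gluings,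
  one-point fibres of `T`).

No definition; nothing here takes a side on [IUTchIII] Cor. 3.12.
-/

namespace Literature.AnabelianGeometry.SemiGraphs

open CategoryTheory CategoryTheory.Limits CategoryTheory.PreGaloisCategory
open Literature.AnabelianGeometry.Anabelioids

universe v₁ u₁ u

namespace SemiGraphOfAnabelioids

variable {𝒢 𝒢' : SemiGraphOfAnabelioids.{v₁, u₁, u}}

/-! ### One-point fibres of terminal constituents -/

section Terminal

variable {C : Type*} [Category C] [GaloisCategory C]

/-- The fibre of a terminal object is a single point. [cite: MochizukiSemiAnbd2006, Def. 2.1 p.23] -/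
theorem subsingleton_fiber_of_isTerminal (F : C ⥤ FintypeCat.{v₁}) [FiberFunctor F] {X : C}
    (hX : IsTerminal X) : Subsingleton (F.obj X) := by
  obtain ⟨eT⟩ := nonempty_equiv_fiber_terminal_punit F
  let i : X ≅ ⊤_ C := hX.uniqueUpToIso terminalIsTerminal
  exact ((FintypeCat.equivEquivIso.symm (F.mapIso i)).trans eT).subsingleton

/-- The fibre of a terminal object is non-empty. [cite: MochizukiSemiAnbd2006, Def. 2.1 p.23] -/
theorem nonempty_fiber_of_isTerminal (F : C ⥤ FintypeCat.{v₁}) [FiberFunctor F] {X : C}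
    (hX : IsTerminal X) : Nonempty (F.obj X) := by
  obtain ⟨eT⟩ := nonempty_equiv_fiber_terminal_punit F
  let i : X ≅ ⊤_ C := hX.uniqueUpToIso terminalIsTerminal
  exact ⟨((FintypeCat.equivEquivIso.symm (F.mapIso i)).trans eT).symm PUnit.unit⟩

end Terminal

/-! ### Fibre functors are injective on isomorphisms -/

/-- `F(i)` is injective for an isomorphism `i`. [cite: MochizukiSemiAnbd2006, Def. 2.1 p.23] -/
theorem map_iso_injective {C : Type*} [Category C] (F : C ⥤ FintypeCat.{v₁}) {X Y : C} (i : X ≅ Y) :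
    Function.Injective (F.map i.hom) := by
  intro a b h
  have h' := congrArg (F.map i.inv) h
  have r : ∀ x, F.map i.inv (F.map i.hom x) = x := fun x => FintypeCat.hom_inv_id_apply (F.mapIso i) x
  rw [r, r] at h'
  exact h'

/-! ### The gluing of a pulled-back object along a branch, unfolded -/

/-- The gluing isomorphism of `φ^* X` along a branch `β` abutting to `ω`, unfolded: the 2-isomorphism
`φ_β`, then `φ_{f′}^*` of the gluing of `X` along `φ β`, then re-indexing along `edgeOf (φ β) = φ f′`.
[cite: MochizukiSemiAnbd2006, Rem. 2.11.1 p.32] -/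
theorem Hom.pullbackFunctor_obj_ψ_hom (φ : Hom 𝒢' 𝒢) (X : 𝒢.BObj) (β : 𝒢'.graph.Branch)
    (ω : 𝒢'.graph.Vertex) (h : 𝒢'.graph.abuts β = some ω) :
    ((φ.pullbackFunctor.obj X).ψ β ω h).hom =
      (φ.φB β ω h).hom.app (X.S (φ.base.vertexMap ω)) ≫
        (φ.φE (𝒢'.graph.edgeOf β) (𝒢.graph.edgeOf (φ.base.branchMap β))
            (φ.base.edgeOf_branchMap β).symm).pullback.map
          (X.ψ (φ.base.branchMap β) (φ.base.vertexMap ω) (φ.base.abuts_branchMap β ω h)).hom ≫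
        (φ.reindexIso (𝒢'.graph.edgeOf β) _ _ (φ.base.edgeOf_branchMap β).symm rfl).hom.app X := by
  rfl

/-! ### Section fibres glue along a branch: the fibre-image inclusion -/

/-- **Section fibres glue along a branch.**  Let `φ : 𝒢′ → 𝒢`, `A ∈ B(𝒢)`, `ℍ ⊆ 𝔾`, `T ∈ B(𝒢′)` with
terminal constituents and `s : T → φ^* A` (a section); `Y ∈ B(𝒢_ℍ)` with `f : Y → A|_ℍ`; `β` a branch of
`𝒢′` abutting to `ω`, over `b := φ β` abutting to `u := φ ω`, both in `ℍ`; `ι_c : c → Y_u` and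
`ι_d : d → Y_{e}` (`e` the edge of `b`) with `d` UNDER `c` along `b` (`k ≫ b^* ι_c ≫ ψ^Y_b = ι_d`).  Write
`Ψ_c := φ_ω^* c ×_{φ_ω^* A_u} T_ω` (section fibre at the vertex, section `s_ω`) and
`Ψ_d := φ_{f′}^* d ×_{φ_{f′}^* A_e} T_{f′}` (section fibre at the edge `f′` of `β`, with the edge section
TRANSPORTED from `s_ω` along `β`: `T.ψ_β⁻¹ ≫ β^* s_ω ≫ φ_β ≫ φ_{f′}^* ψ^A_b`).  Then every point of the
fibre-image of `Ψ_d → φ_{f′}^* Y_e` comes from a point of `β^* Ψ_c` through `β^*(Ψ_c → φ_ω^* Y_u)`, the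
2-isomorphism `φ_β` and `φ_{f′}^*` of the gluing `ψ^Y_b` — i.e. along the gluing of `φ^* Y` at `β`
(naturality of `φ_β`, compatibility of `f` with the gluings). [cite: MochizukiSemiAnbd2006, Cor. 2.7(i) p.30] -/
theorem Hom.exists_point_pull_sectionFibre (φ : Hom 𝒢' 𝒢) (A : 𝒢.BObj) (H : 𝒢.graph.Subgraph)
    (T : 𝒢'.BObj) (hTV : ∀ v', IsTerminal (T.S v')) (hTE : ∀ e', IsTerminal (T.T e'))
    (s : T ⟶ φ.pullbackFunctor.obj A)
    (β : 𝒢'.graph.Branch) (ω : 𝒢'.graph.Vertex) (hβω : 𝒢'.graph.abuts β = some ω)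
    (huH : φ.base.vertexMap ω ∈ H.verts) (heH : 𝒢.graph.edgeOf (φ.base.branchMap β) ∈ H.edges)
    (Y : (𝒢.restrict H).BObj) (f : Y ⟶ (𝒢.restrictFunctor H).obj A)
    {c : 𝒢.V (φ.base.vertexMap ω)} (ιc : c ⟶ Y.S ⟨φ.base.vertexMap ω, huH⟩)
    {d : 𝒢.E (𝒢.graph.edgeOf (φ.base.branchMap β))}
    (ιd : d ⟶ Y.T ⟨𝒢.graph.edgeOf (φ.base.branchMap β), heH⟩)
    (k : d ⟶ (𝒢.pull (φ.base.branchMap β) (φ.base.vertexMap ω)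
      (φ.base.abuts_branchMap β ω hβω)).pullback.obj c)
    (hk : k ≫ (𝒢.pull (φ.base.branchMap β) (φ.base.vertexMap ω)
        (φ.base.abuts_branchMap β ω hβω)).pullback.map ιc ≫
      (Y.ψ ⟨φ.base.branchMap β, heH⟩ ⟨φ.base.vertexMap ω, huH⟩
        ((SemiGraph.Subgraph.abuts_eq_some_iff H _ _).mpr (φ.base.abuts_branchMap β ω hβω))).hom = ιd)
    (Fe : 𝒢'.E (𝒢'.graph.edgeOf β) ⥤ FintypeCat.{v₁}) [FiberFunctor Fe]
    (π : Fe.obj (pullback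
      ((φ.φE (𝒢'.graph.edgeOf β) (𝒢.graph.edgeOf (φ.base.branchMap β))
          (φ.base.edgeOf_branchMap β).symm).pullback.map
        (ιd ≫ f.fT ⟨𝒢.graph.edgeOf (φ.base.branchMap β), heH⟩))
      ((T.ψ β ω hβω).inv ≫ (𝒢'.pull β ω hβω).pullback.map (s.fS ω) ≫
        (φ.φB β ω hβω).hom.app (A.S (φ.base.vertexMap ω)) ≫
        (φ.φE (𝒢'.graph.edgeOf β) (𝒢.graph.edgeOf (φ.base.branchMap β))
            (φ.base.edgeOf_branchMap β).symm).pullback.map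
          (A.ψ (φ.base.branchMap β) (φ.base.vertexMap ω) (φ.base.abuts_branchMap β ω hβω)).hom))) :
    ∃ ρ : Fe.obj ((𝒢'.pull β ω hβω).pullback.obj
        (pullback ((φ.φV ω).pullback.map (ιc ≫ f.fS ⟨φ.base.vertexMap ω, huH⟩)) (s.fS ω))),
      Fe.map ((𝒢'.pull β ω hβω).pullback.map
          (pullback.fst ((φ.φV ω).pullback.map (ιc ≫ f.fS ⟨φ.base.vertexMap ω, huH⟩)) (s.fS ω) ≫
            (φ.φV ω).pullback.map ιc) ≫
        (φ.φB β ω hβω).hom.app (Y.S ⟨φ.base.vertexMap ω, huH⟩) ≫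
        (φ.φE (𝒢'.graph.edgeOf β) (𝒢.graph.edgeOf (φ.base.branchMap β))
            (φ.base.edgeOf_branchMap β).symm).pullback.map
          (Y.ψ ⟨φ.base.branchMap β, heH⟩ ⟨φ.base.vertexMap ω, huH⟩
            ((SemiGraph.Subgraph.abuts_eq_some_iff H _ _).mpr (φ.base.abuts_branchMap β ω hβω))).hom) ρ =
      Fe.map (pullback.fst _ _ ≫
        (φ.φE (𝒢'.graph.edgeOf β) (𝒢.graph.edgeOf (φ.base.branchMap β))
          (φ.base.edgeOf_branchMap β).symm).pullback.map ιd) π := by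
  -- notation (all morphisms ascribed in applied form, so that compositions elaborate uniformly)
  have hbu : H.toSemiGraph.abuts ⟨φ.base.branchMap β, heH⟩ =
      some (⟨φ.base.vertexMap ω, huH⟩ : H.toSemiGraph.Vertex) :=
    (SemiGraph.Subgraph.abuts_eq_some_iff H _ _).mpr (φ.base.abuts_branchMap β ω hβω)
  let Φω : 𝒢.V (φ.base.vertexMap ω) ⥤ 𝒢'.V ω := (φ.φV ω).pullback
  let Φe : 𝒢.E (𝒢.graph.edgeOf (φ.base.branchMap β)) ⥤ 𝒢'.E (𝒢'.graph.edgeOf β) :=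
    (φ.φE (𝒢'.graph.edgeOf β) (𝒢.graph.edgeOf (φ.base.branchMap β))
      (φ.base.edgeOf_branchMap β).symm).pullback
  let B : 𝒢'.V ω ⥤ 𝒢'.E (𝒢'.graph.edgeOf β) := (𝒢'.pull β ω hβω).pullback
  let bY : 𝒢.V (φ.base.vertexMap ω) ⥤ 𝒢.E (𝒢.graph.edgeOf (φ.base.branchMap β)) :=
    (𝒢.pull (φ.base.branchMap β) (φ.base.vertexMap ω) (φ.base.abuts_branchMap β ω hβω)).pullback
  haveI : PreservesFiniteLimits B := (𝒢'.pull β ω hβω).property.1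
  haveI : PreservesFiniteColimits B := (𝒢'.pull β ω hβω).property.2
  let Fb : 𝒢'.V ω ⥤ FintypeCat.{v₁} := B ⋙ Fe
  haveI : FiberFunctor Fb := fiberFunctor_comp_of_exact _ _
  let φBh : ∀ X : 𝒢.V (φ.base.vertexMap ω), B.obj (Φω.obj X) ⟶ Φe.obj (bY.obj X) :=
    fun X => (φ.φB β ω hβω).hom.app X
  let φBi : ∀ X : 𝒢.V (φ.base.vertexMap ω), Φe.obj (bY.obj X) ⟶ B.obj (Φω.obj X) :=
    fun X => (φ.φB β ω hβω).inv.app X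
  let Aψh : bY.obj (A.S (φ.base.vertexMap ω)) ⟶ A.T (𝒢.graph.edgeOf (φ.base.branchMap β)) :=
    (A.ψ (φ.base.branchMap β) (φ.base.vertexMap ω) (φ.base.abuts_branchMap β ω hβω)).hom
  let Yψh : bY.obj (Y.S ⟨φ.base.vertexMap ω, huH⟩) ⟶
      Y.T ⟨𝒢.graph.edgeOf (φ.base.branchMap β), heH⟩ :=
    (Y.ψ ⟨φ.base.branchMap β, heH⟩ ⟨φ.base.vertexMap ω, huH⟩ hbu).hom
  let sω : T.S ω ⟶ Φω.obj (A.S (φ.base.vertexMap ω)) := s.fS ω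
  let Tψh : B.obj (T.S ω) ⟶ T.T (𝒢'.graph.edgeOf β) := (T.ψ β ω hβω).hom
  let Tψi : T.T (𝒢'.graph.edgeOf β) ⟶ B.obj (T.S ω) := (T.ψ β ω hβω).inv
  let fu : Y.S ⟨φ.base.vertexMap ω, huH⟩ ⟶ A.S (φ.base.vertexMap ω) :=
    f.fS ⟨φ.base.vertexMap ω, huH⟩
  let fe : Y.T ⟨𝒢.graph.edgeOf (φ.base.branchMap β), heH⟩ ⟶
      A.T (𝒢.graph.edgeOf (φ.base.branchMap β)) :=
    f.fT ⟨𝒢.graph.edgeOf (φ.base.branchMap β), heH⟩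
  let sE : T.T (𝒢'.graph.edgeOf β) ⟶ Φe.obj (A.T (𝒢.graph.edgeOf (φ.base.branchMap β))) :=
    Tψi ≫ B.map sω ≫ φBh (A.S (φ.base.vertexMap ω)) ≫ Φe.map Aψh
  let g₁ : Φe.obj d ⟶ Φe.obj (A.T (𝒢.graph.edgeOf (φ.base.branchMap β))) := Φe.map (ιd ≫ fe)
  -- one-point fibres of the terminal constituents
  haveI : Subsingleton (Fe.obj (T.T (𝒢'.graph.edgeOf β))) :=
    subsingleton_fiber_of_isTerminal Fe (hTE _)
  haveI : Subsingleton (Fb.obj (T.S ω)) := subsingleton_fiber_of_isTerminal Fb (hTV _)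
  obtain ⟨tE⟩ := nonempty_fiber_of_isTerminal Fe (hTE (𝒢'.graph.edgeOf β))
  obtain ⟨tV⟩ := nonempty_fiber_of_isTerminal Fb (hTV ω)
  -- (1) morphism-level identities
  have hk₀ : k ≫ bY.map ιc ≫ Yψh = ιd := hk
  have hf : bY.map fu ≫ Aψh = Yψh ≫ fe :=
    f.comm ⟨φ.base.branchMap β, heH⟩ ⟨φ.base.vertexMap ω, huH⟩ hbu
  have hk' : k ≫ bY.map ιc ≫ bY.map fu ≫ Aψh = ιd ≫ fe := by
    calc k ≫ bY.map ιc ≫ bY.map fu ≫ Aψh = k ≫ bY.map ιc ≫ Yψh ≫ fe := by rw [hf]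
      _ = (k ≫ bY.map ιc ≫ Yψh) ≫ fe := by simp only [Category.assoc]
      _ = ιd ≫ fe := by rw [hk₀]
  have ih : ∀ X : 𝒢.V (φ.base.vertexMap ω), φBi X ≫ φBh X = 𝟙 _ :=
    fun X => (φ.φB β ω hβω).inv_hom_id_app X
  have e1 : φBi c ≫ B.map (Φω.map (ιc ≫ fu)) =
      Φe.map (bY.map (ιc ≫ fu)) ≫ φBi (A.S (φ.base.vertexMap ω)) :=
    ((φ.φB β ω hβω).inv.naturality (ιc ≫ fu)).symm
  have e2 : φBi c ≫ B.map (Φω.map ιc) =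
      Φe.map (bY.map ιc) ≫ φBi (Y.S ⟨φ.base.vertexMap ω, huH⟩) :=
    ((φ.φB β ω hβω).inv.naturality ιc).symm
  have hmA : Φe.map k ≫ φBi c ≫ B.map (Φω.map (ιc ≫ fu)) ≫
      φBh (A.S (φ.base.vertexMap ω)) ≫ Φe.map Aψh = g₁ := by
    calc Φe.map k ≫ φBi c ≫ B.map (Φω.map (ιc ≫ fu)) ≫ φBh (A.S (φ.base.vertexMap ω)) ≫ Φe.map Aψh
        = Φe.map k ≫ (φBi c ≫ B.map (Φω.map (ιc ≫ fu))) ≫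
            φBh (A.S (φ.base.vertexMap ω)) ≫ Φe.map Aψh := by simp only [Category.assoc]
      _ = Φe.map k ≫ (Φe.map (bY.map (ιc ≫ fu)) ≫ φBi (A.S (φ.base.vertexMap ω))) ≫
            φBh (A.S (φ.base.vertexMap ω)) ≫ Φe.map Aψh := by rw [e1]
      _ = Φe.map k ≫ Φe.map (bY.map (ιc ≫ fu)) ≫
            (φBi (A.S (φ.base.vertexMap ω)) ≫ φBh (A.S (φ.base.vertexMap ω))) ≫ Φe.map Aψh := by
            simp only [Category.assoc]
      _ = Φe.map (k ≫ bY.map (ιc ≫ fu) ≫ Aψh) := by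
            rw [ih, Category.id_comp, ← Φe.map_comp, ← Φe.map_comp]
      _ = g₁ := by rw [bY.map_comp, Category.assoc, hk']
  have hmY : Φe.map k ≫ φBi c ≫ B.map (Φω.map ιc) ≫ φBh (Y.S ⟨φ.base.vertexMap ω, huH⟩) ≫
      Φe.map Yψh = Φe.map ιd := by
    calc Φe.map k ≫ φBi c ≫ B.map (Φω.map ιc) ≫ φBh (Y.S ⟨φ.base.vertexMap ω, huH⟩) ≫ Φe.map Yψh
        = Φe.map k ≫ (φBi c ≫ B.map (Φω.map ιc)) ≫ φBh (Y.S ⟨φ.base.vertexMap ω, huH⟩) ≫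
            Φe.map Yψh := by simp only [Category.assoc]
      _ = Φe.map k ≫ (Φe.map (bY.map ιc) ≫ φBi (Y.S ⟨φ.base.vertexMap ω, huH⟩)) ≫
            φBh (Y.S ⟨φ.base.vertexMap ω, huH⟩) ≫ Φe.map Yψh := by rw [e2]
      _ = Φe.map k ≫ Φe.map (bY.map ιc) ≫
            (φBi (Y.S ⟨φ.base.vertexMap ω, huH⟩) ≫ φBh (Y.S ⟨φ.base.vertexMap ω, huH⟩)) ≫
              Φe.map Yψh := by simp only [Category.assoc]
      _ = Φe.map (k ≫ bY.map ιc ≫ Yψh) := by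
            rw [ih, Category.id_comp, ← Φe.map_comp, ← Φe.map_comp]
      _ = Φe.map ιd := by rw [hk₀]
  have hsE : B.map sω ≫ φBh (A.S (φ.base.vertexMap ω)) ≫ Φe.map Aψh = Tψh ≫ sE := by
    show _ = (T.ψ β ω hβω).hom ≫ (T.ψ β ω hβω).inv ≫ B.map sω ≫
      φBh (A.S (φ.base.vertexMap ω)) ≫ Φe.map Aψh
    rw [Iso.hom_inv_id_assoc]
  -- (2) the first coordinate `δ` of `π` lies over the transported section point
  let δ : Fe.obj (Φe.obj d) := Fe.map (pullback.fst g₁ sE) π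
  have hδ : Fe.map g₁ δ = Fe.map sE tE := by
    change Fe.map g₁ (Fe.map (pullback.fst g₁ sE) π) = _
    rw [← FintypeCat.comp_apply, ← Fe.map_comp, pullback.condition, Fe.map_comp,
      FintypeCat.comp_apply]
    congr 1
    exact Subsingleton.elim _ _
  -- (3) the candidate first coordinate at the vertex and its section condition
  let ρ' : Fb.obj (Φω.obj c) := Fe.map (φBi c) (Fe.map (Φe.map k) δ)
  have h1 : Fe.map (Φe.map Aψh) (Fe.map (φBh (A.S (φ.base.vertexMap ω)))
      (Fe.map (B.map (Φω.map (ιc ≫ fu))) ρ')) = Fe.map g₁ δ := by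
    rw [← hmA]
    simp only [Functor.map_comp, FintypeCat.comp_apply]
    rfl
  have h2 : Fe.map (B.map sω ≫ φBh (A.S (φ.base.vertexMap ω)) ≫ Φe.map Aψh) tV =
      Fe.map (Tψh ≫ sE) tV := by rw [hsE]
  rw [Fe.map_comp Tψh sE, FintypeCat.comp_apply, Subsingleton.elim (Fe.map Tψh tV) tE] at h2
  simp only [Functor.map_comp, FintypeCat.comp_apply] at h2
  have hρ'2 : Fb.map (Φω.map (ιc ≫ fu)) ρ' = Fb.map sω tV :=
    map_iso_injective Fe ((φ.φB β ω hβω).app (A.S (φ.base.vertexMap ω)))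
      (map_iso_injective Fe (Φe.mapIso
        (A.ψ (φ.base.branchMap β) (φ.base.vertexMap ω) (φ.base.abuts_branchMap β ω hβω)))
        (h1.trans (hδ.trans h2.symm)))
  -- (4) the point `ρ` of `β^* Ψ_c`
  let ρ : Fb.obj (pullback (Φω.map (ιc ≫ fu)) sω) :=
    (fiberPullbackEquiv Fb (Φω.map (ιc ≫ fu)) sω).symm ⟨(ρ', tV), hρ'2⟩
  have hρ : Fe.map (B.map (pullback.fst (Φω.map (ιc ≫ fu)) sω)) ρ = ρ' :=
    fiberPullbackEquiv_symm_fst_apply Fb ρ' tV hρ'2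
  refine ⟨ρ, ?_⟩
  have h3 : Fe.map (Φe.map Yψh) (Fe.map (φBh (Y.S ⟨φ.base.vertexMap ω, huH⟩))
      (Fe.map (B.map (Φω.map ιc)) ρ')) = Fe.map (Φe.map ιd) δ := by
    rw [← hmY]
    simp only [Functor.map_comp, FintypeCat.comp_apply]
    rfl
  have h4 : Fe.map (B.map (pullback.fst (Φω.map (ιc ≫ fu)) sω ≫ Φω.map ιc) ≫
        φBh (Y.S ⟨φ.base.vertexMap ω, huH⟩) ≫ Φe.map Yψh) ρ =
      Fe.map (Φe.map Yψh) (Fe.map (φBh (Y.S ⟨φ.base.vertexMap ω, huH⟩))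
        (Fe.map (B.map (Φω.map ιc)) (Fe.map (B.map (pullback.fst (Φω.map (ιc ≫ fu)) sω)) ρ))) := by
    simp only [Functor.map_comp, FintypeCat.comp_apply]
  have h6 : Fe.map (pullback.fst g₁ sE ≫ Φe.map ιd) π = Fe.map (Φe.map ιd) δ := by
    rw [Fe.map_comp, FintypeCat.comp_apply]
  rw [hρ] at h4
  exact h4.trans (h3.trans h6.symm)

end SemiGraphOfAnabelioids

end Literature.AnabelianGeometry.SemiGraphs
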